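import Mathlib.Algebra.BigOperators.Fin
import Mathlib.Algebra.BigOperators.Pi
import Mathlib.Data.Fintype.BigOperators
import Mathlib.Data.ZMod.Basic
import Mathlib.Algebra.Field.ZMod
import Mathlib.Data.Matrix.Mul
import Mathlib.LinearAlgebra.Dimension.Constructions
import Mathlib.LinearAlgebra.FiniteDimensional.Lemmas
import Mathlib.LinearAlgebra.StdBasis
import Mathlib.Tactic.Ring

/-!
# The odd-degree parity law: in every CM slice of degree `≡ 2 (mod 4)` at least (number of simple factors) `− 1` Galois orbits of exceptional generators are needed (kernel census, uniform in the Galois type)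

COR-CM (cell `pub-hodgecm2`), count-neutral kernel census by the binder seat b17 (gen 48; claim ODD-PARITY-LAW): the UNIFORM form
of the parity argument of `Census/DodecicDicyclicSpecies.lean`, `…/DodecicCyclicSpecies.lean`, `…/DodecicC6C2Species.lean`
(`five_le_card_of_generates`, b17 gen 39) and `Census/TetradecicCyclicSpecies.lean` (`nine_le_card_of_generates`, lit-andre-3
gen 13, whose memo states the «`ℤ/2p` law `μ(ℤ/2p) ≥ (2^{p−1}−1)/p`»).  One theorem for every Galois CM type `(G, c)` with
`|G| ≡ 2 (mod 4)` and every family of blocks: no `decide` table, no certificate, no named fact, no geometry, no `sorry`.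
HC_CM is not proved anywhere in this cell; nothing here is a headline and nothing here produces a period.

DICTIONARY (cited, not formalised; identical to the per-degree census files).  `F` a Galois CM field, `G = Gal(F/ℚ) = Hom(F, ℚ̄)`,
`c ∈ Z(G)` complex conjugation; a CM type of `(G, c)` is `T ⊆ G` with `T ⊔ cT = G`; isogeny classes of simple CM abelian varieties
SPLIT BY `F` ↔ `G`-orbits of CM types under translation, the stabiliser `H_T` cuts out the CM field `K = F^{H_T}`,
`dim = |G|/2|H_T|`, eigen-labels of `H¹` = cosets `G/H_T`, translation = Galois conjugation [cite: Milne1999, Prop. 2.1 and the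
paragraph after it, p. 54]; a class monomial with exponent vector `m ≥ 0` on a product of powers of the simple factors is a Hodge
class iff all Pohlmann forms vanish [cite: Pohlmann1968, Thm 1]; conjugate pairs = divisor classes.  `μ(G, c)` := the least
number of Galois orbits of integer vectors which, together with the pairs, generate the Hodge lattice of the whole slice.

THE ODD CASE.  `|G| ≡ 2 (mod 4)` with `c` central forces `G = ⟨c⟩ × A` with `|A| = |G|/2` odd (normal `2`-complement; for the
tree's Galois CM fields cf. `CorCM/GaloisCMFieldsTwiceOddDegreePair.lean`).  Then CM types `↔` maps `φ : A → ℤ/2`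
(`T_φ = {(φ y, y)}`), `G = ℤ/2 × A` acts by `((a₀,y₀)·φ)(y) = φ(y − y₀) + a₀`, and — because a map on a group of ODD order has no
anti-period `φ(y + y₀) = φ(y) + 1` (sequel file `Census/OddDegreeParityLawCyclicPrime.lean`) — every stabiliser is `{0} × Per(φ)`:
every simple factor `B` has the label set `ℤ/2 × A_B`, `A_B = A / Per(φ)` of ODD order, with `G` acting through `A ↠ A_B`, and
its type is the graph of the descended map `φ_B : A_B → ℤ/2`.  The two constant maps form one orbit: the CM elliptic curve `E` of
the imaginary quadratic subfield `k = F^A` (`A_E = 0`).  Examples: `ℤ/6, ℤ/10, ℤ/14, ℤ/18, ℤ/6×ℤ/3, ℤ/22, ℤ/26, ℤ/30, …`,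
`Gal(ℚ(ζ_p)/ℚ)` for `p ≡ 3 (mod 4)`.

THE MODEL (this file, generic).  Data: any additive group `A`; a finite index type `ι` of blocks; for each block `b` a finite
additive group `A_b` (`Ab b`), a homomorphism `π_b : A →+ A_b` and a map `φ_b : A_b → ℤ/2`.  Labels `Pt = Σ b, ℤ/2 × A_b`;
`act` = translation through `π`; total type `Φ = {(b, a, y) : a = φ_b y}` (`inPhi`); `hodgeVec g` = Pohlmann's `±1` coefficient
vector of `g ∈ ℤ/2 × A`; `hodgeLattice` (`H`, a `Submodule ℤ (Pt → ℤ)`), `pairs` (`P`), `transl`, exactly as in the per-degree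
files (which are the instances `A_b = G/H_T` written out label by label); `parity : ℤ^{Pt} →ₗ[ℤ] 𝔽₂^ι` = block parities.

THE LAW (`card_le_card_add_one_of_generates`, `card_sub_one_le_card_of_generates`).  If every `|A_b|` is odd and some block `e`
has `A_e = 0`, then for every finite family `S ⊂ ℤ^{Pt}` with `H ≤ P + Σ_{t ∈ S} ℤ[G]·t` one has `|S| ≥ |ι| − 1`.  For the faithful
full slice (`ι` = all simple factors) this is `μ(G, c) ≥ (number of isogeny classes of simple CM abelian varieties split by F) − 1`,
and the same bound holds for every sub-slice containing `E` (with `ι` the factors kept).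
PROOF (kernel).  `parity` is `ℤ`-linear, translation invariant (`parity_transl`) and kills the pairs (`parity_pairVec`), so
`parity(P + ℤ[G]·S) ⊆ span_{𝔽₂}(parity S)`, of dimension `≤ |S|`.  For each block `b` the WEIL VECTOR
`w_b = half(b) + d(b)·e_{(e, φ_e 0 + 1, 0)}` — `half(b)` = all labels `(0, y)` of block `b` (the `k`-eigen-half of `H¹(B_b)`),
`d(b) = 2·#{φ_b = 0} − |A_b|` the (odd) signature defect — is a Hodge vector (`weilVec_mem`: the form of `g` on `half(b)` is
`± d(b)` by re-indexing along `y ↦ y + π_b g.2`, `hodgeVec_dotProduct_half`, and `∓ d(b)` on the `E`-part); it is, up to pairs and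
sign, the exponent vector of the classical exceptional (Weil) class on the CM abelian variety `E^{|d(b)|} × B_b` of Weil type
[cite: Weil1977HodgeRing; Gordon1999HodgeAVSurvey, §7].  Its parity is `e_b + e_e` (`parity_weilVec`, as `|A_b|` and `d(b)`
are odd).  Hence `span(parity S) + 𝔽₂·e_e = 𝔽₂^ι` and `|ι| ≤ |S| + 1` (`card_le_card_add_one_of_forall_add_single_mem`).

INSTANCES (dictionary arithmetic — orbit counts —, NOT decided in this file).  Number of non-`E` simple factors, hence the bound:
`ℤ/6: 1`, `ℤ/10: 3`, `ℤ/14: 9` (the landed / filed per-degree constants, where equality holds by certificate), `ℤ/18: 1 + 28 = 29`,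
`ℤ/6×ℤ/3: 4 + 27 = 31`, `ℤ/22: 93`, `ℤ/26: 315`, `ℤ/30: 1 + 3 + 1091 = 1095`; for `A = ℤ/p`, `p` an odd prime, `(2^{p−1} − 1)/p`.
So in degrees `≡ 2 (mod 4)` the number of exceptional Galois orbits («face periods per field» of the degree-by-degree lane, when
faces suffice at all) is at least the number of simple CM classes split by `F` minus one, `≈ 2^{|G|/2 − 1}/(|G|/2)`.
NOT CLAIMED: any upper bound (equality `μ = |ι| − 1` is known only at `6, 10, 14`, by the per-degree lattice certificates); the case
`|G| ≡ 0 (mod 4)` (there `half(b)` has even mass; the order-`8`/`12`/`16` rows use other witnesses); anything when `E` is not among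
the blocks.  Open in print as a uniform statement as far as the seat knows (presearch: corpus + galaxy, none).

## References
* [Pohlmann1968] H. Pohlmann, Algebraic cycles on abelian varieties of complex multiplication type, Ann. of Math. 88 (1968), Thm 1.
* [Milne1999] J. S. Milne, Lefschetz motives and the Tate conjecture, Compositio Math. 117 (1999), Prop. 2.1, p. 54.
* [Weil1977HodgeRing] A. Weil, Abelian varieties and the Hodge ring, Œuvres Scientifiques III, [1977c], 421–429.
* [Gordon1999HodgeAVSurvey] B. B. Gordon, A survey of the Hodge conjecture for abelian varieties, Appendix B in J. D. Lewis,
  A Survey of the Hodge Conjecture, 2nd ed., CRM Monograph Series 10 (1999), §7.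
-/

namespace Summit.HodgeConjecture.CorCM.Census.OddDegreeParityLaw

open Finset

/-! ## §1 The odd slice model (generic form of the census genre) -/

section Model

variable {A : Type*} [AddCommGroup A]
variable {ι : Type*} [Fintype ι] [DecidableEq ι]
variable {Ab : ι → Type*} [∀ b, AddCommGroup (Ab b)] [∀ b, Fintype (Ab b)] [∀ b, DecidableEq (Ab b)]

/-- Labels of the slice: block `b ∈ ι` carries the labels `ℤ/2 × A_b` (`= G / Stab(T_b)`). [folklore] -/
abbrev Pt (Ab : ι → Type*) := Σ b : ι, ZMod 2 × Ab b

/-- `G = ℤ/2 × A` acts on the labels of block `b` by translation through `π_b : A → A_b`. [folklore] -/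
def act (π : ∀ b, A →+ Ab b) (g : ZMod 2 × A) (x : Pt Ab) : Pt Ab :=
  ⟨x.1, (x.2.1 + g.1, x.2.2 + π x.1 g.2)⟩

/-- The total type `Φ` (Boolean membership): in block `b` the label `(a, y)` has Hodge type `(1,0)` iff `a = φ_b y`. [folklore] -/
def inPhi (φ : ∀ b, Ab b → ZMod 2) (x : Pt Ab) : Bool := decide (x.2.1 = φ x.1 x.2.2)

/-- Pohlmann's coefficient vector `(2[g·x ∈ Φ] − 1)_x ∈ {±1}^{Pt}` of the Hodge form of `g`. [cite: Pohlmann1968, Thm 1] -/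
def hodgeVec (π : ∀ b, A →+ Ab b) (φ : ∀ b, Ab b → ZMod 2) (g : ZMod 2 × A) (x : Pt Ab) : ℤ :=
  if inPhi φ (act π g x) then 1 else -1

/-- **The Hodge lattice** of the slice: integer exponent vectors killed by every Pohlmann form. [cite: Pohlmann1968, Thm 1] -/
def hodgeLattice (π : ∀ b, A →+ Ab b) (φ : ∀ b, Ab b → ZMod 2) : Submodule ℤ (Pt Ab → ℤ) where
  carrier := {m | ∀ g : ZMod 2 × A, hodgeVec π φ g ⬝ᵥ m = 0}
  zero_mem' := by intro g; simp
  add_mem' := by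
    intro m m' hm hm' g
    rw [dotProduct_add, hm g, hm' g, add_zero]
  smul_mem' := by
    intro c m hm g
    rw [dotProduct_smul, hm g, smul_zero]

/-- The conjugate label `c·x` (`c = (1, 0)`). [folklore] -/
def conj (x : Pt Ab) : Pt Ab := ⟨x.1, (x.2.1 + 1, x.2.2)⟩

/-- The conjugate pair through a label (a divisor-class monomial `e_x ∧ e_{cx}`), as `e_x + e_{cx}`. [folklore] -/
def pairVec (x : Pt Ab) : Pt Ab → ℤ := Pi.single x 1 + Pi.single (conj x) 1

/-- The divisor sublattice `P = ℤ⟨conjugate pairs⟩`. [folklore] -/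
def pairs : Submodule ℤ (Pt Ab → ℤ) := Submodule.span ℤ (Set.range (pairVec (Ab := Ab)))

/-- Galois translate of an exponent vector: `(g·v)(y) = v(g⁻¹·y)`. [folklore] -/
def transl (π : ∀ b, A →+ Ab b) (g : ZMod 2 × A) (v : Pt Ab → ℤ) (y : Pt Ab) : ℤ := v (act π (-g) y)

/-- The block parities `m ↦ (Σ_{x ∈ block b} m_x mod 2)_b`, a `ℤ`-linear map `ℤ^{Pt} → 𝔽₂^ι`. [folklore] -/
def parity : (Pt Ab → ℤ) →ₗ[ℤ] (ι → ZMod 2) where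
  toFun m := fun b => ∑ p : ZMod 2 × Ab b, ((m ⟨b, p⟩ : ℤ) : ZMod 2)
  map_add' m m' := by
    funext b
    simp only [Pi.add_apply, Int.cast_add, Finset.sum_add_distrib]
  map_smul' c m := by
    funext b
    simp only [Pi.smul_apply, smul_eq_mul, Int.cast_mul, RingHom.id_apply, ← Finset.mul_sum, zsmul_eq_mul]

omit [Fintype ι] [∀ b, AddCommGroup (Ab b)] in
/-- Parity of a unit vector. [folklore] -/
theorem parity_single (b₀ : ι) (p₀ : ZMod 2 × Ab b₀) :
    parity (Pi.single (⟨b₀, p₀⟩ : Pt Ab) (1 : ℤ)) = Pi.single b₀ 1 := by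
  funext b
  simp only [parity, LinearMap.coe_mk, AddHom.coe_mk]
  by_cases hb : b = b₀
  · subst hb
    rw [Pi.single_eq_same]
    have h : ∀ p : ZMod 2 × Ab b,
        (((Pi.single (⟨b, p₀⟩ : Pt Ab) (1 : ℤ) : Pt Ab → ℤ) ⟨b, p⟩ : ℤ) : ZMod 2) = if p = p₀ then 1 else 0 := by
      intro p
      by_cases hp : p = p₀
      · subst hp; simp
      · simp [hp]
    simp_rw [h]
    rw [Finset.sum_ite_eq' univ p₀ (fun _ => (1 : ZMod 2))]
    simp
  · rw [Pi.single_eq_of_ne hb]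
    refine Finset.sum_eq_zero fun p _ => ?_
    have hne : (⟨b, p⟩ : Pt Ab) ≠ ⟨b₀, p₀⟩ := fun h => hb (congrArg Sigma.fst h)
    simp [Pi.single_eq_of_ne hne]

omit [Fintype ι] [∀ b, AddCommGroup (Ab b)] in
/-- The parities vanish on conjugate pairs. [folklore] -/
theorem parity_pairVec (x : Pt Ab) : parity (pairVec x) = 0 := by
  obtain ⟨b, p⟩ := x
  unfold pairVec conj
  rw [map_add, parity_single, parity_single]
  funext b'
  simp only [Pi.add_apply, Pi.zero_apply]
  by_cases hb : b' = b
  · subst hb; rw [Pi.single_eq_same]; decide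
  · rw [Pi.single_eq_of_ne hb]; simp

omit [Fintype ι] [DecidableEq ι] [∀ b, DecidableEq (Ab b)] in
/-- The parities are translation invariant. [folklore] -/
theorem parity_transl (π : ∀ b, A →+ Ab b) (g : ZMod 2 × A) (v : Pt Ab → ℤ) :
    parity (transl π g v) = parity v := by
  funext b
  show ∑ p : ZMod 2 × Ab b, ((v (act π (-g) ⟨b, p⟩) : ℤ) : ZMod 2) =
    ∑ p : ZMod 2 × Ab b, ((v ⟨b, p⟩ : ℤ) : ZMod 2)
  exact Fintype.sum_equiv (Equiv.addRight (((-g).1, π b (-g).2) : ZMod 2 × Ab b)) _ _ (fun p => rfl)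

/-! ## §2 The Weil vectors and the parity law -/

/-- `n₀(b)` = the number of labels `y ∈ A_b` with `φ_b y = 0`. [folklore] -/
def n0 (φ : ∀ b, Ab b → ZMod 2) (b : ι) : ℕ := (univ.filter fun y : Ab b => φ b y = 0).card

/-- The signature defect `d(b) = 2 n₀(b) − |A_b|` of block `b` (odd when `|A_b|` is odd). [folklore] -/
def defect (φ : ∀ b, Ab b → ZMod 2) (b : ι) : ℤ := 2 * (n0 φ b : ℤ) - (Fintype.card (Ab b) : ℤ)

/-- The half monomial of block `b`: all labels `(0, y)`, `y ∈ A_b` (the `k`-eigen-half of `H¹(B_b)`). [folklore] -/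
def half (b : ι) : Pt Ab → ℤ := fun x => if x.1 = b ∧ x.2.1 = 0 then 1 else 0

/-- **The Weil vector** of block `b` relative to the block `e` of the CM elliptic curve:
`half(b) + d(b) · e_{(e, φ_e 0 + 1, 0)}`. [folklore] -/
def weilVec (φ : ∀ b, Ab b → ZMod 2) (e : ι) (b : ι) : Pt Ab → ℤ :=
  half b + defect φ b • Pi.single (⟨e, (φ e 0 + 1, 0)⟩ : Pt Ab) (1 : ℤ)

omit [∀ b, DecidableEq (Ab b)] in
/-- The Pohlmann form of `g` on the half monomial of block `b`: `± d(b)` according to `g.1`. [folklore] -/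
theorem hodgeVec_dotProduct_half (π : ∀ b, A →+ Ab b) (φ : ∀ b, Ab b → ZMod 2) (g : ZMod 2 × A) (b : ι) :
    hodgeVec π φ g ⬝ᵥ half b = if g.1 = 0 then defect φ b else -defect φ b := by
  classical
  have h01 : ∀ a : ZMod 2, a = 0 ∨ a = 1 := by decide
  -- reduce the dot product to a sum over the labels `(0, y)` of block `b`
  have step1 : hodgeVec π φ g ⬝ᵥ half b = ∑ y : Ab b, hodgeVec π φ g ⟨b, (0, y)⟩ := by
    unfold dotProduct half
    rw [Fintype.sum_sigma]
    have inner : ∀ b' : ι, (∑ p : ZMod 2 × Ab b', hodgeVec π φ g ⟨b', p⟩ *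
        (if (⟨b', p⟩ : Pt Ab).1 = b ∧ (⟨b', p⟩ : Pt Ab).2.1 = 0 then (1 : ℤ) else 0)) =
        if b' = b then ∑ y : Ab b', hodgeVec π φ g ⟨b', (0, y)⟩ else 0 := by
      intro b'
      by_cases hb : b' = b
      · rw [if_pos hb]
        rw [Fintype.sum_prod_type]
        simp only [hb, true_and, mul_ite, mul_one, mul_zero]
        rw [Finset.sum_comm]
        simp [Finset.sum_ite_eq']
      · rw [if_neg hb]
        refine Finset.sum_eq_zero fun p _ => ?_
        simp [hb]
    simp_rw [inner]
    rw [Finset.sum_ite_eq' univ b]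
    simp
  rw [step1]
  -- evaluate the coefficient at the labels `(0, y)` and re-index by the translation `y ↦ y + π_b g.2`
  have step2 : ∑ y : Ab b, hodgeVec π φ g ⟨b, (0, y)⟩ = ∑ y : Ab b, (if g.1 = φ b y then (1 : ℤ) else -1) := by
    have hcoef : ∀ y : Ab b, hodgeVec π φ g ⟨b, (0, y)⟩ = if g.1 = φ b (y + π b g.2) then (1 : ℤ) else -1 := by
      intro y; simp [hodgeVec, act, inPhi]
    simp_rw [hcoef]
    exact Fintype.sum_equiv (Equiv.addRight (π b g.2)) _ _ (fun y => rfl)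
  rw [step2]
  -- count
  have count : ∀ a : ZMod 2, ∑ y : Ab b, (if a = φ b y then (1 : ℤ) else -1) =
      2 * ((univ.filter fun y : Ab b => φ b y = a).card : ℤ) - (Fintype.card (Ab b) : ℤ) := by
    intro a
    rw [Finset.sum_ite, Finset.sum_const, Finset.sum_const, smul_neg, nsmul_eq_mul, nsmul_eq_mul, mul_one, mul_one]
    have hc := Finset.card_filter_add_card_filter_not (s := (univ : Finset (Ab b))) (fun y : Ab b => a = φ b y)
    rw [Finset.card_univ] at hc
    have hfilt : (univ.filter fun y : Ab b => a = φ b y) = univ.filter fun y : Ab b => φ b y = a := by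
      ext y; simp [eq_comm]
    rw [hfilt] at hc ⊢
    linarith [hc]
  rcases h01 g.1 with h0 | h1
  · rw [h0, count 0, if_pos rfl]; rfl
  · rw [h1, count 1, if_neg (by decide)]
    -- `#{φ = 1} = |A_b| − n₀(b)`
    have hcomp : ((univ.filter fun y : Ab b => φ b y = 1).card : ℤ) =
        (Fintype.card (Ab b) : ℤ) - (n0 φ b : ℤ) := by
      have hc := Finset.card_filter_add_card_filter_not (s := (univ : Finset (Ab b))) (fun y : Ab b => φ b y = 0)
      rw [Finset.card_univ] at hc
      have hfilt : (univ.filter fun y : Ab b => ¬ φ b y = 0) = univ.filter fun y : Ab b => φ b y = 1 := by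
        ext y
        simp only [Finset.mem_filter, Finset.mem_univ, true_and]
        rcases h01 (φ b y) with h | h <;> simp [h]
      rw [hfilt] at hc
      unfold n0
      linarith [hc]
    rw [hcomp]
    unfold defect
    ring

/-- The Pohlmann form of `g` on the unit vector of an `E`-label `(e, a₁, 0)` (block `e` with `A_e = 0`). [folklore] -/
theorem hodgeVec_dotProduct_single_e (π : ∀ b, A →+ Ab b) (φ : ∀ b, Ab b → ZMod 2) (g : ZMod 2 × A) (e : ι)
    (he : ∀ y : Ab e, y = 0) (a₁ : ZMod 2) :
    hodgeVec π φ g ⬝ᵥ Pi.single (⟨e, (a₁, 0)⟩ : Pt Ab) (1 : ℤ) = if a₁ + g.1 = φ e 0 then 1 else -1 := by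
  rw [dotProduct_single, mul_one]
  simp [hodgeVec, act, inPhi, he (0 + π e g.2)]

/-- **The Weil vectors are Hodge vectors.** [folklore] -/
theorem weilVec_mem (π : ∀ b, A →+ Ab b) (φ : ∀ b, Ab b → ZMod 2) (e : ι) (he : ∀ y : Ab e, y = 0) (b : ι) :
    weilVec φ e b ∈ hodgeLattice π φ := by
  have h01 : ∀ a : ZMod 2, a = 0 ∨ a = 1 := by decide
  intro g
  show hodgeVec π φ g ⬝ᵥ (half b + defect φ b • Pi.single (⟨e, (φ e 0 + 1, 0)⟩ : Pt Ab) (1 : ℤ)) = 0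
  rw [dotProduct_add, dotProduct_smul, hodgeVec_dotProduct_half, hodgeVec_dotProduct_single_e π φ g e he]
  rcases h01 g.1 with h0 | h1
  · rw [h0, if_pos rfl, add_zero, if_neg]
    · simp
    · rcases h01 (φ e 0) with h | h <;> rw [h] <;> decide
  · rw [h1, if_neg (by decide), if_pos]
    · simp
    · rcases h01 (φ e 0) with h | h <;> rw [h] <;> decide

omit [Fintype ι] [∀ b, AddCommGroup (Ab b)] [∀ b, DecidableEq (Ab b)] in
/-- Parity of the half monomial: `|A_b| · e_b`. [folklore] -/
theorem parity_half (b : ι) : parity (half (Ab := Ab) b) = fun b' => if b' = b then (Fintype.card (Ab b) : ZMod 2) else 0 := by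
  classical
  funext b'
  simp only [parity, LinearMap.coe_mk, AddHom.coe_mk, half]
  by_cases hb : b' = b
  · subst hb
    simp only [true_and, if_true]
    rw [Fintype.sum_prod_type]
    simp only [Int.cast_ite, Int.cast_one, Int.cast_zero]
    rw [Finset.sum_comm]
    simp only [Finset.sum_ite_eq', Finset.mem_univ, if_true, Finset.sum_const, Finset.card_univ, nsmul_eq_mul, mul_one]
  · simp [hb]

omit [Fintype ι] in
/-- **Parity of the Weil vector** of block `b ≠ e`: the sum of the two unit vectors `e_b + e_e`, provided `|A_b|` is odd. [folklore] -/
theorem parity_weilVec (φ : ∀ b, Ab b → ZMod 2) (e b : ι) (hb : Odd (Fintype.card (Ab b))) :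
    parity (weilVec φ e b) = Pi.single b 1 + Pi.single e 1 := by
  have hN : (Fintype.card (Ab b) : ZMod 2) = 1 := (ZMod.natCast_eq_one_iff_odd).mpr hb
  have hd : ((defect φ b : ℤ) : ZMod 2) = 1 := by
    unfold defect
    push_cast
    rw [hN]
    have : (2 : ZMod 2) = 0 := by decide
    rw [this, zero_mul, zero_sub]
    decide
  unfold weilVec
  rw [map_add, map_zsmul, parity_single, parity_half, zsmul_eq_mul]
  funext b'
  simp only [Pi.add_apply, Pi.mul_apply, Pi.intCast_apply, hd, one_mul]
  by_cases h : b' = b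
  · subst h; simp [hN]
  · simp [h]

/-- Linear algebra over `𝔽₂`: if a span contains `e_b + e_e` for every `b`, it has codimension `≤ 1`. [folklore] -/
theorem card_le_card_add_one_of_forall_add_single_mem (e : ι) (T : Finset (ι → ZMod 2))
    (h : ∀ b : ι, (Pi.single b 1 + Pi.single e 1 : ι → ZMod 2) ∈ Submodule.span (ZMod 2) (T : Set (ι → ZMod 2))) :
    Fintype.card ι ≤ T.card + 1 := by
  classical
  let W : Submodule (ZMod 2) (ι → ZMod 2) := Submodule.span (ZMod 2) (T : Set (ι → ZMod 2))
  let L : Submodule (ZMod 2) (ι → ZMod 2) := Submodule.span (ZMod 2) ({Pi.single e 1} : Set (ι → ZMod 2))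
  have hee : (Pi.single e 1 : ι → ZMod 2) ∈ L := Submodule.subset_span (Set.mem_singleton _)
  have htwo : (Pi.single e 1 + Pi.single e 1 : ι → ZMod 2) = 0 := by
    rw [← Pi.single_add]
    have h11 : (1 : ZMod 2) + 1 = 0 := by decide
    rw [h11, Pi.single_zero]
  have hunit : ∀ b : ι, (Pi.single b 1 : ι → ZMod 2) ∈ W ⊔ L := by
    intro b
    have h3 := Submodule.add_mem _ (Submodule.mem_sup_left (h b) : _ ∈ W ⊔ L) (Submodule.mem_sup_right hee)
    rwa [add_assoc, htwo, add_zero] at h3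
  have htop : W ⊔ L = ⊤ := by
    refine le_antisymm le_top ?_
    rw [← (Pi.basisFun (ZMod 2) ι).span_eq]
    refine Submodule.span_le.mpr ?_
    rintro _ ⟨b, rfl⟩
    simp only [SetLike.mem_coe, Pi.basisFun_apply]
    exact hunit b
  have h1 : Module.finrank (ZMod 2) W ≤ T.card := finrank_span_finset_le_card T
  have h2 : Module.finrank (ZMod 2) L ≤ 1 := by
    simpa using finrank_span_le_card (R := ZMod 2) ({Pi.single e 1} : Set (ι → ZMod 2))
  have h3 : Module.finrank (ZMod 2) (W ⊔ L : Submodule (ZMod 2) (ι → ZMod 2)) ≤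
      Module.finrank (ZMod 2) W + Module.finrank (ZMod 2) L :=
    Submodule.finrank_add_le_finrank_add_finrank W L
  rw [htop, finrank_top, Module.finrank_pi] at h3
  omega

/-- **THE ODD-DEGREE PARITY LAW.**  In an odd slice (all label groups `A_b` of odd order) containing the block `e` of the CM
elliptic curve (`A_e = 0`): if the Hodge lattice is generated, together with the divisor classes, by the Galois translates of a
finite family `S` of integer vectors, then `|S| ≥ |ι| − 1`. [folklore] -/
theorem card_le_card_add_one_of_generates (π : ∀ b, A →+ Ab b) (φ : ∀ b, Ab b → ZMod 2)
    (hodd : ∀ b, Odd (Fintype.card (Ab b))) (e : ι) (he : ∀ y : Ab e, y = 0) (S : Finset (Pt Ab → ℤ))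
    (hS : hodgeLattice π φ ≤ pairs ⊔ Submodule.span ℤ {v | ∃ g : ZMod 2 × A, ∃ t ∈ S, v = transl π g t}) :
    Fintype.card ι ≤ S.card + 1 := by
  classical
  let T : Finset (ι → ZMod 2) := S.image parity
  let W : Submodule ℤ (ι → ZMod 2) := (Submodule.span (ZMod 2) (T : Set (ι → ZMod 2))).restrictScalars ℤ
  have hle : pairs ⊔ Submodule.span ℤ {v | ∃ g : ZMod 2 × A, ∃ t ∈ S, v = transl π g t} ≤ W.comap parity := by
    refine sup_le (Submodule.span_le.mpr ?_) (Submodule.span_le.mpr ?_)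
    · rintro _ ⟨x, rfl⟩
      simp only [SetLike.mem_coe, Submodule.mem_comap, W, Submodule.restrictScalars_mem, parity_pairVec]
      exact Submodule.zero_mem _
    · rintro _ ⟨g, t, ht, rfl⟩
      have hmem : parity t ∈ (T : Set (ι → ZMod 2)) := by
        simp only [T, Finset.coe_image]
        exact Set.mem_image_of_mem parity ht
      simp only [SetLike.mem_coe, Submodule.mem_comap, W, Submodule.restrictScalars_mem, parity_transl]
      exact Submodule.subset_span hmem
  have hsum : ∀ b : ι, (Pi.single b 1 + Pi.single e 1 : ι → ZMod 2) ∈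
      Submodule.span (ZMod 2) (T : Set (ι → ZMod 2)) := by
    intro b
    have h := hle (hS (weilVec_mem π φ e he b))
    rw [Submodule.mem_comap, parity_weilVec φ e b (hodd b)] at h
    exact h
  have hT : T.card ≤ S.card := Finset.card_image_le
  exact (card_le_card_add_one_of_forall_add_single_mem e T hsum).trans (by omega)

/-- **THE ODD-DEGREE PARITY LAW, `μ ≥ |ι| − 1` form**: at least `|ι| − 1` Galois orbits of generators are needed on top of the
divisor classes — for the faithful full slice, at least (number of simple CM isogeny classes split by `F`) `− 1`. [folklore] -/
theorem card_sub_one_le_card_of_generates (π : ∀ b, A →+ Ab b) (φ : ∀ b, Ab b → ZMod 2)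
    (hodd : ∀ b, Odd (Fintype.card (Ab b))) (e : ι) (he : ∀ y : Ab e, y = 0) (S : Finset (Pt Ab → ℤ))
    (hS : hodgeLattice π φ ≤ pairs ⊔ Submodule.span ℤ {v | ∃ g : ZMod 2 × A, ∃ t ∈ S, v = transl π g t}) :
    Fintype.card ι - 1 ≤ S.card := by
  have h := card_le_card_add_one_of_generates π φ hodd e he S hS
  omega

end Model


end Summit.HodgeConjecture.CorCM.Census.OddDegreeParityLaw
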